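import Literature.MathematicalPhysics.QuantumFieldTheory.Balaban1983to89.B9SectBGWordCoCurlY
import Literature.MathematicalPhysics.QuantumFieldTheory.Balaban1983to89.B9Eq382V3Letters
import Literature.MathematicalPhysics.QuantumFieldTheory.Balaban1983to89.B9Eq3104CommutatorSizesCurv
import Literature.MathematicalPhysics.QuantumFieldTheory.Balaban1983to89.B13OpsYPencilHessian

/-!
# Balaban [B9], (3.10) p. 392 — NODE 00's HESSIAN `Δ(U) = D*_U𝒦_UD_U + Δ′₂(U)` (`Node00.hessY`) IS r06's `lapDDLetter + dPrimeLetter` (pv27's `deltaOp`)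
# IN BOND COORDINATES: `partialSum_eq`, ★ `slot_eq`, ★★ `curv2Y_eq_divL` (the commutator term `Δ′₂` IS pv27's `divL (commG₁ … commG₄)`),
# ★★ `hessY_eq_deltaOp`, ★★★ `bondFunCoordsY_hessY` — DESIGN POINT 2b of the pub-ymgap N06 G-side plan (the crux of Route L's identification)

T. Bałaban, *Propagators for lattice gauge theories in a background field*, Commun. Math. Phys. **99** (1985) 389–434
[`Balaban1985BackgroundPropagators`, "B9"].

statement-level skeleton of published theorems with citation tags; proofs where landed; nothing here is a claim about the
Yang–Mills mass gap

THE PRINTED LOCUS (p. 392, (3.10)): *«⟨A, ΔA⟩ = ⟨A, D*DA⟩ + ⟨A, Δ′A⟩, ⟨A, Δ′A⟩ = Σ_{p⊂T_η} η^d tr((D¹_U A)(p))²η⁻²(Re U(∂p) − 1) + tr Σ_{b₁,b₂⊂∂(p)_z,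
b₁≺b₂} i[A′(b₁), A′(b₂)]η⁻² Im U(∂p)»*, with the (3.2) letters `A′` p. 390.

WHY THIS FILE (seat dag-n06-c gen 13; G-SIDE-PLAN v2, Route L, L-3).  The row-13 G frames (`B9SectBGFrameV4.GFrame₄`) spell `Δ_a(V)` as r06's word
`deltaA (conj b (lapDDLetter T η⁻¹ V)) (conj b (dPrimeLetter T V η)) (…) …`; NODE 00's is `deltaAY = hessY + gradY∘RY∘divY + QsY∘aY∘QY`.  After
`B9SectBGWordGradDivY` ∕ `B9SectBGWordDRDY` (the middle word) the identification needs NODE 00's Hessian `hessY U = coCurlY U ∘ jordanY U ∘ curlY U + curv2Y U`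
against pv27's `deltaOp = divPη(curlη ·) + divP(jordanF ·) + divL(commG₁, …, commG₄)` (`B9Eq310Hermitian`), of which r06's letters are the wrappers
`lapDDLetter T c V = c²·lapDD` (`B9Eq372RemLetters`, `lapDD = divP ∘ curl`: `B9Eq371Composition.lapDD_eq_divP_curl`) and `dPrimeLetter T V η = deltaPrimeOp`
(`B9Eq382V3Letters`).  `B9SectBGWordCoCurlY.coCurlY_jordanY_curlY_eq` did the first term; THIS FILE does the commutator term and assembles:
* §1 the letters of `Δ′₂`: `edgeY_vals ∕ sgnY_vals ∕ edgeParY_vals` (rfl), `partialSum_eq` (with def-Y's `B13OpsYPencilHessian.primeEdgeY_apply ∕ commY_apply`) — def-Y's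
  `Σ_{l≻m}A′_l(Λ) − Σ_{l≺m}A′_l(Λ)` IS `−sgnSum_{m+1}` of pv27 in coordinates (the (3.2) letters `A′₁ = −R(U_ν x)Λ⟨x+e_ν, μ⟩`, `A′₂ = −Λ⟨x, ν⟩`, `A′₃ =
  Λ⟨x, μ⟩`, `A′₄ = R(U_μ x)Λ⟨x+e_μ, ν⟩` — same order, same signs, same transporters on both sides);
* §2 ★ `slot_eq` — the def-Y slot value `½σ_mR(V_m)⁻¹ i[Σ_≻ − Σ_≺, c_f²Im U(∂p)]` IS `(−R(U_ν x)⁻¹G₁, −G₂, G₃, R(U_μ x)⁻¹G₄)_m` (pv27's commutator letters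
  `G_k = (i/2)[y, S_k]`, `y = η⁻²Im U(∂p)`, `c_f² = η⁻²`, with their (3.9)-divergence signs and transporters); ★★ `curv2Y_eq_divL` — summing over the
  plaquettes through the bond (def-Y's collapse lemmas `B9Eq3104CommutatorGradFormCurl.sum_plaqY_ite_*`) gives pv27's `divL`;
* §3 ★★ `hessY_eq_deltaOp : hessY U Λ ⟨x, ν⟩ = deltaOp (shiftY) (UboxY U) |c_f|⁻¹ F ν (chart x)`, `F κ w := bondFunCoordsY Λ (κ, w)`, and ★★★
  `bondFunCoordsY_hessY : bondFunCoordsY (hessY U Λ) = lapDDLetter (shiftY) |c_f| (UboxY U) F + dPrimeLetter (shiftY) (UboxY U) |c_f|⁻¹ F` — for EVERY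
  configuration `U`, every field, every complete normed algebra `𝔸`: NODE 00's `Δ(U)` IS r06's word at the charted background (constant `η⁻¹ = |c_f|`).

HONEST SCOPE.  Exact finite-dimensional operator identities between DEFINED objects of two lineages (def-Y's NODE 00 letters, pv27∕r06's Sect.-B letters);
no estimate; nothing of [B9] asserted; count-neutral; N06 NOT discharged; nothing continuum ∕ OS ∕ mass-gap ∕ Clay.  No `sorry`, no `axiom`, no `def`, no
`instance`.  Two `set_option linter.unusedSimpArgs false in` (one shared `simp only` set across a four-slot case split; justified inline).  `--supports
stmt-QuantumFields-27364`.

RELATED IN THE TREE, NOT DUPLICATED: `B9Eq3104CommutatorSizesCurv.curv2Y_apply`, `B9Eq3104CommutatorGradFormCurl` (def-Y — USED), `B13OpsYPencilHessian`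
(def-Y's pencil holomorphy of `hessY`; its `primeEdgeY_apply`∕`commY_apply` — USED), `B9Thm311Curv2Symm`
(lit's matrix-case `curv2Y_apply`), `B9Eq310Hermitian` ∕ `B9Eq371Composition` ∕ `B9Eq372RemLetters` ∕ `B9Eq382V3Letters` (pv27∕r06 — USED),
`B9SectBGWordCurlHolY` ∕ `B9SectBGWordCoCurlY` (gen 13 — USED).
-/
noncomputable section

namespace Literature.MathematicalPhysics.QuantumFieldTheory.Balaban1983to89.B9SectBGWordHessY

open Literature.MathematicalPhysics.QuantumFieldTheory.Balaban1983to89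
open Literature.MathematicalPhysics.QuantumFieldTheory.Balaban1983to89.B6KLevelCensusIndexV1 (KIdx)
open Literature.MathematicalPhysics.QuantumFieldTheory.Balaban1983to89.B9Eq39Adjoint (R R_one R_smul R_add R_sub R_neg covD covDstar curl plaqU divP divPη curlη divP_smul)
open Literature.MathematicalPhysics.QuantumFieldTheory.Balaban1983to89.B9Eq37Insertion (reC imC)
open Literature.MathematicalPhysics.QuantumFieldTheory.Balaban1983to89.B9Eq310Hermitian (jordanF zP yP divL commG₁ commG₂ commG₃ commG₄ sgnSum₁ sgnSum₂ sgnSum₃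
  sgnSum₄ deltaPrimeOp deltaOp divP_add)
open Literature.MathematicalPhysics.QuantumFieldTheory.Balaban1983to89.B9Eq371Composition (lapDD lapDD_eq_divP_curl)
open Literature.MathematicalPhysics.QuantumFieldTheory.Balaban1983to89.B9Eq372RemLetters (lapDDLetter lapDDLetter_apply)
open Literature.MathematicalPhysics.QuantumFieldTheory.Balaban1983to89.B9Eq382V3Letters (dPrimeLetter dPrimeLetter_apply)
open Literature.MathematicalPhysics.QuantumFieldTheory.Balaban1983to89.B9Eq3104CommutatorGradFormCurl (extP sum_plaqY_ite_src_mu sum_plaqY_ite_src_nu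
  sum_plaqY_ite_shift_mu sum_plaqY_ite_shift_nu)
open Literature.MathematicalPhysics.QuantumFieldTheory.Balaban1983to89.B9Eq3104CommutatorSizesCurv (curv2Y_apply)
open Literature.MathematicalPhysics.QuantumFieldTheory.Balaban1983to89.B13OpsYPencilHessian (primeEdgeY_apply commY_apply)
open Literature.MathematicalPhysics.QuantumFieldTheory.Balaban1983to89.B9SectBGWordCurlHolY (curlY_eq_curl holY_eq_plaqU imHolY_eq_imC UboxY_chartY)
open Literature.MathematicalPhysics.QuantumFieldTheory.Balaban1983to89.B9SectBGWordCoCurlY (coCurlY_jordanY_curlY_eq cf_sq_eq)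
open Literature.MathematicalPhysics.QuantumFieldTheory.Balaban1983to89.Node00 (SiteY FBondY PlaqY CfgY UboxY shiftY curlY coCurlY jordanY curv2Y hessY holY imHolY
  edgeY sgnY edgeParY primeEdgeY commY bondCoordsY bondFunCoordsY bondFunCoordsY_apply bondCoordsY_symm_mk)
open Literature.MathematicalPhysics.QuantumFieldTheory.Balaban1983to89.Node00.OpsYNablaBridge (chartY chartY_eq shiftY_chartY shiftY_symm_chartY)

variable {𝔸 : Type} [NormedRing 𝔸] [NormedAlgebra ℂ 𝔸] [CompleteSpace 𝔸]
variable {d ℓ : ℕ} {hd : 1 ≤ d + 1} {hL : Odd (ℓ + 1) ∧ 1 < ℓ + 1} {b₀ b₁ : ℝ}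
variable (i : KIdx d ℓ hd hL b₀ b₁)

/-! ## §1 The letters of `Δ′₂`: slots, signs, transporters, partial sums -/

omit [NormedRing 𝔸] [NormedAlgebra ℂ 𝔸] [CompleteSpace 𝔸] in
/-- the four edges of `∂p` (def-Y order `⟨x+e_ν, μ⟩, ⟨x, ν⟩, ⟨x, μ⟩, ⟨x+e_μ, ν⟩`). [cite: Balaban1985BackgroundPropagators, (3.2) p.390, bookkeeping] -/
theorem edgeY_vals (p : PlaqY i) :
    edgeY i p 0 = ⟨p.src.shift p.ν, p.μ⟩ ∧ edgeY i p 1 = ⟨p.src, p.ν⟩ ∧ edgeY i p 2 = ⟨p.src, p.μ⟩ ∧ edgeY i p 3 = ⟨p.src.shift p.μ, p.ν⟩ :=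
  ⟨rfl, rfl, rfl, rfl⟩

omit [NormedRing 𝔸] [NormedAlgebra ℂ 𝔸] [CompleteSpace 𝔸] in
/-- the signs `σ = (−1, −1, 1, 1)`. [cite: Balaban1985BackgroundPropagators, (3.2)/(3.5) pp.390–391, bookkeeping] -/
theorem sgnY_vals : sgnY 0 = -1 ∧ sgnY 1 = -1 ∧ sgnY 2 = 1 ∧ sgnY 3 = 1 := ⟨rfl, rfl, rfl, rfl⟩

/-- the transporters `(U_ν(x), 1, 1, U_μ(x))`. [cite: Balaban1985BackgroundPropagators, (3.2) p.390, bookkeeping] -/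
theorem edgeParY_vals (U : CfgY 𝔸 i) (p : PlaqY i) :
    edgeParY i U p 0 = U p.ν p.src ∧ edgeParY i U p 1 = 1 ∧ edgeParY i U p 2 = 1 ∧ edgeParY i U p 3 = U p.μ p.src := ⟨rfl, rfl, rfl, rfl⟩

-- one shared `simp only` set serves the four slots; some entries are unused in some slots (lint debt, justified: 4-way case split)
set_option linter.unusedSimpArgs false in
/-- the four primed letters of `p = ⟨x, μ, ν⟩` ARE pv27's: `A′₁ = −R(U_ν x)Λ⟨x+e_ν, μ⟩`, `A′₂ = −Λ⟨x, ν⟩`, `A′₃ = Λ⟨x, μ⟩`, `A′₄ = R(U_μ x)Λ⟨x+e_μ, ν⟩` —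
so def-Y's `Σ_{l≻m}A′_l − Σ_{l≺m}A′_l` is `−sgnSum_{m+1}` in coordinates. [cite: Balaban1985BackgroundPropagators, (3.2) p.390] -/
theorem partialSum_eq (U : CfgY 𝔸 i) (p : PlaqY i) (Λ : FBondY i → 𝔸) (m : Fin 4) :
    (∑ l : Fin 4, (if m < l then primeEdgeY i U p l else 0)) Λ - (∑ l : Fin 4, (if l < m then primeEdgeY i U p l else 0)) Λ =
      -(![sgnSum₁ (shiftY i) (UboxY i U) (fun κ w => bondFunCoordsY i Λ (κ, w)) p.μ p.ν (chartY i p.src),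
          sgnSum₂ (shiftY i) (UboxY i U) (fun κ w => bondFunCoordsY i Λ (κ, w)) p.μ p.ν (chartY i p.src),
          sgnSum₃ (shiftY i) (UboxY i U) (fun κ w => bondFunCoordsY i Λ (κ, w)) p.μ p.ν (chartY i p.src),
          sgnSum₄ (shiftY i) (UboxY i U) (fun κ w => bondFunCoordsY i Λ (κ, w)) p.μ p.ν (chartY i p.src)] m) := by
  -- the letters in coordinates
  have hsymm : ∀ s, (B6GlobalChartV1.boxEquiv i.hN).symm (chartY i s) = s := fun s => by
    rw [← chartY_eq]; exact Equiv.symm_apply_apply _ _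
  have hF : ∀ (κ : Fin (d + 1)) (s : Site (B6GlobalChartV1.PV d ℓ i.m i.K hd hL) 0), bondFunCoordsY i Λ (κ, chartY i s) = Λ ⟨s, κ⟩ := fun κ s => by
    rw [bondFunCoordsY_apply, bondCoordsY_symm_mk, hsymm]
  have hFT : ∀ (κ μ' : Fin (d + 1)) (s : Site (B6GlobalChartV1.PV d ℓ i.m i.K hd hL) 0),
      bondFunCoordsY i Λ (κ, shiftY i μ' (chartY i s)) = Λ ⟨s.shift μ', κ⟩ := fun κ μ' s => by rw [shiftY_chartY, hF]
  have h01 : (0 : Fin 4) < 1 := by decide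
  have h02 : (0 : Fin 4) < 2 := by decide
  have h03 : (0 : Fin 4) < 3 := by decide
  have h12 : (1 : Fin 4) < 2 := by decide
  have h13 : (1 : Fin 4) < 3 := by decide
  have h23 : (2 : Fin 4) < 3 := by decide
  have n00 : ¬ (0 : Fin 4) < 0 := by decide
  have n10 : ¬ (1 : Fin 4) < 0 := by decide
  have n20 : ¬ (2 : Fin 4) < 0 := by decide
  have n30 : ¬ (3 : Fin 4) < 0 := by decide
  have n11 : ¬ (1 : Fin 4) < 1 := by decide
  have n21 : ¬ (2 : Fin 4) < 1 := by decide
  have n31 : ¬ (3 : Fin 4) < 1 := by decide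
  have n22 : ¬ (2 : Fin 4) < 2 := by decide
  have n32 : ¬ (3 : Fin 4) < 2 := by decide
  have n33 : ¬ (3 : Fin 4) < 3 := by decide
  match m with
  | 0 =>
      simp only [Fin.sum_univ_four, h01, h02, h03, h12, h13, h23, n00, n10, n20, n30, n11, n21, n31,
        n22, n32, n33, if_true, if_false, LinearMap.add_apply, LinearMap.zero_apply, primeEdgeY_apply, (edgeY_vals i p).1, (edgeY_vals i p).2.1,
        (edgeY_vals i p).2.2.1, (edgeY_vals i p).2.2.2, sgnY_vals.1, sgnY_vals.2.1, sgnY_vals.2.2.1, sgnY_vals.2.2.2, (edgeParY_vals i U p).1,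
        (edgeParY_vals i U p).2.1, (edgeParY_vals i U p).2.2.1, (edgeParY_vals i U p).2.2.2, R_one, one_smul, Matrix.cons_val_zero, Matrix.cons_val_one,
        Matrix.head_cons, Matrix.cons_val_two, Matrix.tail_cons, Matrix.cons_val_three, sgnSum₁, sgnSum₂, sgnSum₃, sgnSum₄, hF, hFT, UboxY_chartY, zero_add,
        add_zero, sub_zero, zero_sub]
      module
  | 1 =>
      simp only [Fin.sum_univ_four, h01, h02, h03, h12, h13, h23, n00, n10, n20, n30, n11, n21, n31,
        n22, n32, n33, if_true, if_false, LinearMap.add_apply, LinearMap.zero_apply, primeEdgeY_apply, (edgeY_vals i p).1, (edgeY_vals i p).2.1,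
        (edgeY_vals i p).2.2.1, (edgeY_vals i p).2.2.2, sgnY_vals.1, sgnY_vals.2.1, sgnY_vals.2.2.1, sgnY_vals.2.2.2, (edgeParY_vals i U p).1,
        (edgeParY_vals i U p).2.1, (edgeParY_vals i U p).2.2.1, (edgeParY_vals i U p).2.2.2, R_one, one_smul, Matrix.cons_val_zero, Matrix.cons_val_one,
        Matrix.head_cons, Matrix.cons_val_two, Matrix.tail_cons, Matrix.cons_val_three, sgnSum₁, sgnSum₂, sgnSum₃, sgnSum₄, hF, hFT, UboxY_chartY, zero_add,
        add_zero, sub_zero, zero_sub]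
      module
  | 2 =>
      simp only [Fin.sum_univ_four, h01, h02, h03, h12, h13, h23, n00, n10, n20, n30, n11, n21, n31,
        n22, n32, n33, if_true, if_false, LinearMap.add_apply, LinearMap.zero_apply, primeEdgeY_apply, (edgeY_vals i p).1, (edgeY_vals i p).2.1,
        (edgeY_vals i p).2.2.1, (edgeY_vals i p).2.2.2, sgnY_vals.1, sgnY_vals.2.1, sgnY_vals.2.2.1, sgnY_vals.2.2.2, (edgeParY_vals i U p).1,
        (edgeParY_vals i U p).2.1, (edgeParY_vals i U p).2.2.1, (edgeParY_vals i U p).2.2.2, R_one, one_smul, Matrix.cons_val_zero, Matrix.cons_val_one,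
        Matrix.head_cons, Matrix.cons_val_two, Matrix.tail_cons, Matrix.cons_val_three, sgnSum₁, sgnSum₂, sgnSum₃, sgnSum₄, hF, hFT, UboxY_chartY, zero_add,
        add_zero, sub_zero, zero_sub]
      module
  | 3 =>
      simp only [Fin.sum_univ_four, h01, h02, h03, h12, h13, h23, n00, n10, n20, n30, n11, n21, n31,
        n22, n32, n33, if_true, if_false, LinearMap.add_apply, LinearMap.zero_apply, primeEdgeY_apply, (edgeY_vals i p).1, (edgeY_vals i p).2.1,
        (edgeY_vals i p).2.2.1, (edgeY_vals i p).2.2.2, sgnY_vals.1, sgnY_vals.2.1, sgnY_vals.2.2.1, sgnY_vals.2.2.2, (edgeParY_vals i U p).1,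
        (edgeParY_vals i U p).2.1, (edgeParY_vals i U p).2.2.1, (edgeParY_vals i U p).2.2.2, R_one, one_smul, Matrix.cons_val_zero, Matrix.cons_val_one,
        Matrix.head_cons, Matrix.cons_val_two, Matrix.tail_cons, Matrix.cons_val_three, sgnSum₁, sgnSum₂, sgnSum₃, sgnSum₄, hF, hFT, UboxY_chartY, zero_add,
        add_zero, sub_zero, zero_sub]
      module

omit [NormedAlgebra ℂ 𝔸] [CompleteSpace 𝔸] in
/-- `−S·M − M·(−S) = M·S − S·M`. [folklore] [cite: Balaban1985BackgroundPropagators, (3.10) p.392, bookkeeping] -/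
theorem neg_comm_aux (M S : 𝔸) : -S * M - M * -S = M * S - S * M := by noncomm_ring

set_option linter.unusedSimpArgs false in
/-- ★ the def-Y slot value of `Δ′₂` at `(p, m)` IS pv27's commutator letter `G_{m+1}(p)` with its (3.9)-divergence sign and transporter:
`½·σ_m·R(V_m)⁻¹(i[Σ_{≻}A′ − Σ_{≺}A′, c_f²Im U(∂p)]) = (−R(U_ν x)⁻¹G₁, −G₂, G₃, R(U_μ x)⁻¹G₄)_m`. [cite: Balaban1985BackgroundPropagators, (3.10) p.392, (3.9) p.392] -/
theorem slot_eq (U : CfgY 𝔸 i) (Λ : FBondY i → 𝔸) (p : PlaqY i) (m : Fin 4) :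
    (1 / 2 : ℂ) • (sgnY m • R (edgeParY i U p m)⁻¹ (commY (((i.cf ^ 2 : ℝ) : ℂ) • imHolY i U p)
        ((∑ l : Fin 4, (if m < l then primeEdgeY i U p l else 0)) Λ - (∑ l : Fin 4, (if l < m then primeEdgeY i U p l else 0)) Λ))) =
      ![-(R (U p.ν p.src)⁻¹ (commG₁ (shiftY i) (UboxY i U) (|i.cf|⁻¹) (fun κ w => bondFunCoordsY i Λ (κ, w)) p.μ p.ν (chartY i p.src))),
        -(commG₂ (shiftY i) (UboxY i U) (|i.cf|⁻¹) (fun κ w => bondFunCoordsY i Λ (κ, w)) p.μ p.ν (chartY i p.src)),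
        commG₃ (shiftY i) (UboxY i U) (|i.cf|⁻¹) (fun κ w => bondFunCoordsY i Λ (κ, w)) p.μ p.ν (chartY i p.src),
        R (U p.μ p.src)⁻¹ (commG₄ (shiftY i) (UboxY i U) (|i.cf|⁻¹) (fun κ w => bondFunCoordsY i Λ (κ, w)) p.μ p.ν (chartY i p.src))] m := by
  have hy : yP (shiftY i) (UboxY i U) (|i.cf|⁻¹) p.μ p.ν (chartY i p.src) = ((i.cf ^ 2 : ℝ) : ℂ) • imHolY i U p := by
    rw [yP, imHolY_eq_imC, Complex.ofReal_inv, inv_inv, ← Complex.ofReal_pow, sq_abs]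
  rw [partialSum_eq, commY_apply]
  match m with
  | 0 =>
      simp only [Matrix.cons_val_zero, sgnY_vals.1, (edgeParY_vals i U p).1, commG₁, hy, neg_comm_aux, R_smul, smul_smul, neg_smul, one_smul, smul_neg]
      rw [show (1 / 2 * (-1 * Complex.I) : ℂ) = -(Complex.I / 2) by ring, neg_smul]
  | 1 =>
      simp only [Matrix.cons_val_zero, Matrix.cons_val_one, Matrix.cons_val_two, Matrix.cons_val_three, Matrix.head_cons, Matrix.tail_cons, sgnY_vals.2.1, (edgeParY_vals i U p).2.1, commG₂, hy, neg_comm_aux, R_smul, inv_one, R_one,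
        smul_smul, neg_smul, one_smul, smul_neg]
      rw [show (1 / 2 * (-1 * Complex.I) : ℂ) = -(Complex.I / 2) by ring, neg_smul]
  | 2 =>
      simp only [Matrix.cons_val_zero, Matrix.cons_val_one, Matrix.cons_val_two, Matrix.cons_val_three, Matrix.head_cons, Matrix.tail_cons, sgnY_vals.2.2.1, (edgeParY_vals i U p).2.2.1, commG₃, hy, neg_comm_aux, R_smul,
        inv_one, R_one, smul_smul, neg_smul, one_smul, smul_neg]
      module
  | 3 =>
      simp only [Matrix.cons_val_zero, Matrix.cons_val_one, Matrix.cons_val_two, Matrix.cons_val_three, Matrix.head_cons, Matrix.tail_cons, sgnY_vals.2.2.2, (edgeParY_vals i U p).2.2.2, commG₄, hy, neg_comm_aux, R_smul,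
        smul_smul, neg_smul, one_smul, smul_neg]
      module

/-! ## §2 The slots and the commutator term -/

/-- ★★ **NODE 00's commutator term `Δ′₂(U)` at the bond `⟨x, ν⟩` IS pv27's letter divergence of the four commutator letter functions** (same (3.2)
letters, same order, same signs, same transporters — collected per bond by def-Y over `(p, m)` with `b_m(p) = b` and by pv27 over the four slot sums).
[cite: Balaban1985BackgroundPropagators, (3.10) p.392, (3.2) p.390, (3.9) p.392] -/
theorem curv2Y_eq_divL (U : CfgY 𝔸 i) (Λ : FBondY i → 𝔸) (x : Site (B6GlobalChartV1.PV d ℓ i.m i.K hd hL) 0) (ν : Fin (d + 1)) :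
    curv2Y i U Λ ⟨x, ν⟩ =
      divL (shiftY i) (UboxY i U)
        (commG₁ (shiftY i) (UboxY i U) (|i.cf|⁻¹) (fun κ w => bondFunCoordsY i Λ (κ, w)))
        (commG₂ (shiftY i) (UboxY i U) (|i.cf|⁻¹) (fun κ w => bondFunCoordsY i Λ (κ, w)))
        (commG₃ (shiftY i) (UboxY i U) (|i.cf|⁻¹) (fun κ w => bondFunCoordsY i Λ (κ, w)))
        (commG₄ (shiftY i) (UboxY i U) (|i.cf|⁻¹) (fun κ w => bondFunCoordsY i Λ (κ, w))) ν (chartY i x) := by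
  classical
  -- abbreviations for the four pv27 letters
  set G₁ := commG₁ (shiftY i) (UboxY i U) (|i.cf|⁻¹) (fun κ w => bondFunCoordsY i Λ (κ, w)) with hG₁
  set G₂ := commG₂ (shiftY i) (UboxY i U) (|i.cf|⁻¹) (fun κ w => bondFunCoordsY i Λ (κ, w)) with hG₂
  set G₃ := commG₃ (shiftY i) (UboxY i U) (|i.cf|⁻¹) (fun κ w => bondFunCoordsY i Λ (κ, w)) with hG₃
  set G₄ := commG₄ (shiftY i) (UboxY i U) (|i.cf|⁻¹) (fun κ w => bondFunCoordsY i Λ (κ, w)) with hG₄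
  -- the def-Y slot term
  set W : PlaqY i → Fin 4 → 𝔸 := fun p m => (1 / 2 : ℂ) • (sgnY m • R (edgeParY i U p m)⁻¹ (commY (((i.cf ^ 2 : ℝ) : ℂ) • imHolY i U p)
      ((∑ l : Fin 4, (if m < l then primeEdgeY i U p l else 0)) Λ - (∑ l : Fin 4, (if l < m then primeEdgeY i U p l else 0)) Λ))) with hW
  have hslot : ∀ p m, W p m = ![-(R (U p.ν p.src)⁻¹ (G₁ p.μ p.ν (chartY i p.src))), -(G₂ p.μ p.ν (chartY i p.src)), G₃ p.μ p.ν (chartY i p.src),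
      R (U p.μ p.src)⁻¹ (G₄ p.μ p.ν (chartY i p.src))] m := fun p m => slot_eq i U Λ p m
  -- `curv2Y` as the sum over the four slots of the collapsed plaquette sums
  have hL : curv2Y i U Λ ⟨x, ν⟩ = ∑ m : Fin 4, ∑ p : PlaqY i, if edgeY i p m = ⟨x, ν⟩ then W p m else 0 := by
    rw [curv2Y_apply, Finset.smul_sum, Finset.sum_comm]
    refine Finset.sum_congr rfl fun m _ => ?_
    rw [Finset.smul_sum]
    refine Finset.sum_congr rfl fun p _ => ?_
    split_ifs <;> simp [hW]
  rw [hL, Fin.sum_univ_four]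
  have e0 : ∀ p : PlaqY i, (edgeY i p 0 = ⟨x, ν⟩) = ((⟨p.src.shift p.ν, p.μ⟩ : FBondY i) = ⟨x, ν⟩) := fun p => rfl
  have e1 : ∀ p : PlaqY i, (edgeY i p 1 = ⟨x, ν⟩) = ((⟨p.src, p.ν⟩ : FBondY i) = ⟨x, ν⟩) := fun p => rfl
  have e2 : ∀ p : PlaqY i, (edgeY i p 2 = ⟨x, ν⟩) = ((⟨p.src, p.μ⟩ : FBondY i) = ⟨x, ν⟩) := fun p => rfl
  have e3 : ∀ p : PlaqY i, (edgeY i p 3 = ⟨x, ν⟩) = ((⟨p.src.shift p.μ, p.ν⟩ : FBondY i) = ⟨x, ν⟩) := fun p => rfl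
  simp only [e0, e1, e2, e3]
  rw [sum_plaqY_ite_shift_nu i (fun p => W p 0) ⟨x, ν⟩, sum_plaqY_ite_src_nu i (fun p => W p 1) ⟨x, ν⟩,
    sum_plaqY_ite_src_mu i (fun p => W p 2) ⟨x, ν⟩, sum_plaqY_ite_shift_mu i (fun p => W p 3) ⟨x, ν⟩]
  simp only [hslot, Matrix.cons_val_zero, Matrix.cons_val_one, Matrix.head_cons, Matrix.cons_val_two, Matrix.tail_cons, Matrix.cons_val_three]
  -- the pv27 side: `divL` with `(T c)⁻¹(chart x) = chart (x − e_c)`, `V c (chart (x − e_c)) = U_c(x − e_c)`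
  rw [divL]
  simp only [shiftY_symm_chartY, UboxY_chartY, dite_eq_ite]
  -- rearrange the four sums
  rw [show (∑ a : Fin (d + 1), if a < ν then R (U a (x.unshift a))⁻¹ (G₄ a ν (chartY i (x.unshift a))) - G₂ a ν (chartY i x) else (0 : 𝔸)) =
      (∑ a : Fin (d + 1), if a < ν then R (U a (x.unshift a))⁻¹ (G₄ a ν (chartY i (x.unshift a))) else 0) -
        ∑ a : Fin (d + 1), if a < ν then G₂ a ν (chartY i x) else 0 by
      rw [← Finset.sum_sub_distrib]; exact Finset.sum_congr rfl fun a _ => by split_ifs <;> simp,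
    show (∑ c : Fin (d + 1), if ν < c then R (U c (x.unshift c))⁻¹ (G₁ ν c (chartY i (x.unshift c))) - G₃ ν c (chartY i x) else (0 : 𝔸)) =
      (∑ c : Fin (d + 1), if ν < c then R (U c (x.unshift c))⁻¹ (G₁ ν c (chartY i (x.unshift c))) else 0) -
        ∑ c : Fin (d + 1), if ν < c then G₃ ν c (chartY i x) else 0 by
      rw [← Finset.sum_sub_distrib]; exact Finset.sum_congr rfl fun c _ => by split_ifs <;> simp]
  have s0 : (∑ c : Fin (d + 1), if ν < c then -(R (U c (x.unshift c))⁻¹ (G₁ ν c (chartY i (x.unshift c)))) else (0 : 𝔸)) =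
      -∑ c : Fin (d + 1), if ν < c then R (U c (x.unshift c))⁻¹ (G₁ ν c (chartY i (x.unshift c))) else 0 := by
    rw [← Finset.sum_neg_distrib]; exact Finset.sum_congr rfl fun c _ => by split_ifs <;> simp
  have s1 : (∑ a : Fin (d + 1), if a < ν then -(G₂ a ν (chartY i x)) else (0 : 𝔸)) = -∑ a : Fin (d + 1), if a < ν then G₂ a ν (chartY i x) else 0 := by
    rw [← Finset.sum_neg_distrib]; exact Finset.sum_congr rfl fun a _ => by split_ifs <;> simp
  rw [s0, s1]
  abel

/-! ## §3 ★★★ The Hessian -/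

/-- ★★ NODE 00's Hessian at a bond IS pv27's `deltaOp` (`= D*_ηD_η + Δ′`) in coordinates. [cite: Balaban1985BackgroundPropagators, (3.10) p.392] -/
theorem hessY_eq_deltaOp (U : CfgY 𝔸 i) (Λ : FBondY i → 𝔸) (x : Site (B6GlobalChartV1.PV d ℓ i.m i.K hd hL) 0) (ν : Fin (d + 1)) :
    hessY i U Λ ⟨x, ν⟩ = deltaOp (shiftY i) (UboxY i U) (|i.cf|⁻¹) (fun κ w => bondFunCoordsY i Λ (κ, w)) ν (chartY i x) := by
  rw [hessY, LinearMap.add_apply, Pi.add_apply, coCurlY_jordanY_curlY_eq, curv2Y_eq_divL, deltaOp, deltaPrimeOp, add_assoc]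

/-- ★★★ **DESIGN POINT 2b — NODE 00's `Δ(U)` IS r06's `lapDDLetter + dPrimeLetter` IN BOND COORDINATES**: `bondFunCoordsY (hessY U Λ) = lapDDLetter (shiftY) |c_f| (UboxY U) F + dPrimeLetter (shiftY) (UboxY U) |c_f|⁻¹ F`,
`F := bondFunCoordsY Λ`. [cite: Balaban1985BackgroundPropagators, (3.10) p.392] -/
theorem bondFunCoordsY_hessY (U : CfgY 𝔸 i) (Λ : FBondY i → 𝔸) :
    bondFunCoordsY i (hessY i U Λ) =
      lapDDLetter (shiftY i) ((|i.cf| : ℝ) : ℂ) (UboxY i U) (bondFunCoordsY i Λ) + dPrimeLetter (shiftY i) (UboxY i U) (|i.cf|⁻¹) (bondFunCoordsY i Λ) := by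
  funext p
  obtain ⟨ν, z⟩ := p
  obtain ⟨x, rfl⟩ := (chartY i).surjective z
  have hsymm : (B6GlobalChartV1.boxEquiv i.hN).symm (chartY i x) = x := by
    rw [← chartY_eq]; exact Equiv.symm_apply_apply _ _
  rw [bondFunCoordsY_apply, bondCoordsY_symm_mk, hsymm, Pi.add_apply, lapDDLetter_apply, dPrimeLetter_apply, hessY_eq_deltaOp, deltaOp,
    lapDD_eq_divP_curl, divPη]
  have hη : ((|i.cf|⁻¹ : ℝ) : ℂ)⁻¹ = ((|i.cf| : ℝ) : ℂ) := by rw [Complex.ofReal_inv, inv_inv]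
  have hcurlη : curlη (shiftY i) (UboxY i U) (|i.cf|⁻¹) (fun κ w => bondFunCoordsY i Λ (κ, w)) =
      ((|i.cf| : ℝ) : ℂ) • curl (shiftY i) (UboxY i U) (fun κ w => bondFunCoordsY i Λ (κ, w)) := by
    funext μ ν' z
    rw [curlη, hη]
    rfl
  rw [hcurlη, divP_smul, hη, smul_smul, ← sq]

end Literature.MathematicalPhysics.QuantumFieldTheory.Balaban1983to89.B9SectBGWordHessY

end
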